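import Summits.AnomalousDissipation.AnomalousDissipation.Theorems.SolenoidalFractalHomogenisationLagrangianStepVmodFfModeGrid
import Summits.AnomalousDissipation.AnomalousDissipation.Theorems.SolenoidalFractalHomogenisationLagrangianStepVmodFfReduceP
import Summits.AnomalousDissipation.AnomalousDissipation.Theorems.SolenoidalFractalHomogenisationLagrangianStepVmodSSGridBlockP
import Summits.AnomalousDissipation.AnomalousDissipation.Theorems.SolenoidalFractalHomogenisationLagrangianStepVmodFsGridBlockP
import HarnessLib

/-!
# K1L_D (stmt-AnomalousDissipation-27980): (V_mod) FLAT STAGE — THE (ff) BLOCK AT GRID PHASE and THE CLOSING FILE OF THE FLAT (ℓ2) LAYER: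
# **`bffP_lane : Bff_textEVHP (fun σ => min (σ/2) (1/2))`** and **`lossFlatWP_lane : lossFlatWP_of_V_textEH (fun σ => min (σ/2) (1/2))`**
(prover ad-k3l-bookkeeping-p1 g10; RULING D28-17 (a): «(ff) grid twin stays with the k3l lineage … file it together with the one-line instantiation
`lossFlatWP_lane := lossFlatWP_of_blocksEVHP bssP_half bsfP_lane bfsP_half bffP_lane coarseSupp` as the CLOSING FILE of the flat (ℓ2) layer»;
`--kind proof --supports 27980 --as helper`)

* `bffP_grid e he : Bff_textEVHP e` for every exponent map with `0 < e σ ≤ 1/2` — the per-label text `ffModeP_grid` (`…VmodFfModeGrid`) through the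
  reduction `bffP_of_ffModeP` (`…VmodFfReduceP`);
* `bffP_lane` — the lane instance `σ ↦ min (σ/2) (1/2)`;
* `lossFlatWP_lane` — the FLAT-STAGE TARGET at grid starts (`…VmodFlatBlocksP.lossFlatWP_of_V_textEH`) from the four blocks of record:
  (ss) `bssP_half` (p723830, ad-k1loc-p3 g11 over ad-sawtooth-k1loc-p1 g15), (sf) `bsfP_lane` (p725568), (fs) `bfsP_half` (p722536, ad-k1loc-p3),
  (ff) `bffP_lane` (this file), and `coarseSupp` (`…VmodCoarseSupp`), by `lossFlatWP_of_blocksEVHP` (p721357).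
`sorry`-free.  This closes the flat (ℓ2) layer `(V) ⇒ LossFlatWᴾ` for the lane exponent; it is NOT a proof of `stub_Vmod_EHTthg` (the (ℓ3) distorted
layer and the Euler glue are separate), of K1L_D or of AD; rung F-D1.A0.
-/

set_option linter.dupNamespace false

noncomputable section

namespace Summit.AnomalousDissipation.AnomalousDissipation.Theorems.SolenoidalFractalHomogenisation.LagrangianStep.VmodFlat

/-- **THE (ff) BLOCK AT GRID PHASE** for every exponent map with `0 < e σ ≤ 1/2`. -/
theorem bffP_grid (e : ℝ → ℝ) (he : ∀ σ, 0 < σ → 0 < e σ ∧ e σ ≤ 1 / 2) : Bff_textEVHP e :=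
  bffP_of_ffModeP e he (ffModeP_grid e he)

/-- **THE (ff) BLOCK AT GRID PHASE FOR THE LANE'S EXPONENT MAP `σ ↦ min (σ/2) (1/2)`** — the (ff) input of `lossFlatWP_of_blocksEVHP`. -/
theorem bffP_lane : Bff_textEVHP (fun σ => min (σ / 2) (1 / 2)) :=
  bffP_grid _ fun _ hσ => ⟨lt_min (half_pos hσ) one_half_pos, min_le_right _ _⟩

/-- **THE FLAT (ℓ2) LAYER, CLOSED: `(V) ⇒ LossFlatWᴾ` for the lane exponent `σ ↦ min (σ/2) (1/2)`** — the four blocks of record and the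
coarse-support fact assembled by `lossFlatWP_of_blocksEVHP`. -/
theorem lossFlatWP_lane : lossFlatWP_of_V_textEH (fun σ => min (σ / 2) (1 / 2)) :=
  lossFlatWP_of_blocksEVHP _ coarseSupp bssP_half bsfP_lane bfsP_half bffP_lane

end Summit.AnomalousDissipation.AnomalousDissipation.Theorems.SolenoidalFractalHomogenisation.LagrangianStep.VmodFlat

end
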